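import Summits.QuantumFields.YangMills.Theorems.BalabanUVNodesN20LCSRestrictedChessboardCubes
import Summits.QuantumFields.YangMills.Theorems.CoarseStiffnessTailCappedCoarseStiffnessLUniformMeanAction
import HarnessLib

/-!
# REGIONAL BARE STIFFNESS — the β-uniform exponential moment of the plaquette energy of an ARBITRARY REGION of the finest torus,
# under the level-`K` Wilson–Gibbs law `gibbsK` of Bałaban's `SU(2)` three-tori (cell `ym3-torus`, rung R3 = YM₃ on T³ — NOT Clay)

Width seat `ym-ust-19936-w3` g17, helper `--supports stmt-QuantumFields-23532` (`PoincareLipschitz.MesoscopicConcentrationL`, K1′; the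
lane of crux `UnitScaleTilt.HistoryTailL`, stmt-QuantumFields-19936; engine of stub `stub_localBoxExpMoment` of LINE 30 «CurvaturePoincare»,
skeleton `Cruxes/HistoryTailL/Lines/curvature_poincare.lean` of ideator `ym-r3-idea-2` g16).  THEOREMS ONLY (no `def`), compositions BY NAME.

THE POINT.  Seat `ym-line-cst-p1`'s ✓`CoarseStiffnessTailUniformMeanAction.exists_bareStiffness_le` is the GLOBAL exponential moment
`∫ exp(c₀·β_K·Σ_a dist₁(U(∂a))²) dμ_K ≤ exp(E·#Plaq₀)` WITHOUT any `log β_K` slack (from the exact two-sided torus free energy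
✓`log_partitionFn_ratio_le_exact`).  THIS FILE LOCALISES IT: for EVERY finite set `Q` of finest plaquettes

  `∫ exp(c·β_K·Σ_{a∈Q} dist₁(U(∂a))²) dμ_K ≤ exp(E·#Q)`      (every `0 ≤ c ≤ 1/16`, one absolute `E ≥ 0`; all `F`, `0 < γ ≤ 1`, `K`),

i.e. the plaquette energy of a region costs `e^{O(#Q)}` at the natural scale `1/β_K` — NO power of `β_K`, NO volume factor.  (The companion
file `CurvaturePoincareStubLocalBoxExpMoment` reads it on the boxes of LINE 30 «CurvaturePoincare» — stub `stub_localBoxExpMoment` of crux 23532's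
registered skeleton — and records the Chebyshev corollaries: the regional energy tail `μ_K{u ≤ Σ_{a∈Q} dist₁²} ≤ e^{E·#Q}·e^{−c·β_K·u}` and the
β-UNIFORM JOINT PEIERLS bound `μ_K{∀ a ∈ Q, s ≤ dist₁(U(∂a))} ≤ e^{E·#Q}·e^{−c·β_K·#Q·s²}` at EVERY threshold, i.e. ✓`…LBareUniformCount.jointPeierls_bare`
without its Haar entropy `(√β_K)^9` per member; the single-plaquette face is ✓p739489 `stub_uniformPlaquetteTail` of LINE 29.)

MECHANISM (all inputs landed; [FrohlichIsraelLiebSimon1978] Thm 4.1 is the only printed theorem behind them):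
1. `dist₁² ≤ 4(1 − Re tr)` on `SU(2)` (✓`B10Eq71TorusLocal.dist1_sq_le_specialUnitaryGroup`), so it suffices to bound the moment of the
   ENERGIES `Σ_{a∈Q}(1 − Re tr U(∂a))` at `a = 4c ≤ 1/4`.
2. Every plaquette `a` lies in the closed unit cube cornered at `a.src`, so `Σ_{a∈Q}(1 − Re tr) ≤ Σ_{c ∈ src(Q)} E_c` with the CUBE ENERGIES
   `E_c = Σ_{p ⊂ [c,c+1]^d}(1 − Re tr U(∂p))` of Track A's N20 files (`plaqEnergy_sum_le_cubeEnergy_sum`, §1).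
3. THE CHESSBOARD FOR CUBE PRODUCTS with trivial weight: ✓`N20LCSRestrictedChessboard.chessboard_exp_cubeEnergy` (site reflections in every
   axis on the even torus, any `Params`, `SU(N)`): `⟨∏_{c∈S} e^{tE_c}⟩ ≤ ⟨∏_c e^{tE_c}⟩^{#S/N^d}` (§1, `integral_prod_exp_cubeEnergy_le_rpow`).
4. In `d = 3` every plaquette lies in EXACTLY two closed unit cubes, so `Σ_c E_c ≤ 2·A` (`sum_cubeEnergy_le_two_mul`, sharpening the `2^d` of
   ✓`N20LCSConditional.sum_cubeEnergy_le`); `∫ e^{sA} dμ_β = Z(β − s)/Z(β)` (✓`CoarseStiffnessTailPressureConvexity.integral_exp_mul_action_eq`) and,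
   for `G = SU(2)`, `1 ≤ β ≤ 2(β − s)`: `Z(β − s)/Z(β) ≤ e^{E·|T|}` (✓`log_partitionFn_ratio_le_exact`); the `#S/N³`-th power of `e^{E·N³}` is
   `e^{E·#S} ≤ e^{E·#Q}` (§2, `localExpMoment_gibbsMeasure_d3`, `0 ≤ a ≤ 1/4` — the d = 3 twin of Track A's `P.d = 4`-only
   ✓`N20LCSAtRecordLevelZero.localExpMoment_gibbsMeasure`, UNCONDITIONAL here through the exact torus exponent).
5. §3 reads it for `gibbsK F ℰp γ K = gibbsMeasure (F.P K) β_K` (`β_K = (γL^{−K})⁻¹ ≥ 1`) in the `dist₁²` currency.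

WHY (for the 23532 lane).  It is the level-0 «restricted stability» input that any Peierls step over REGIONS (rather than single plaquettes)
of a deep-box attempt at `MesoscopicConcentrationL`, a LINE-29-type bookkeeping at the level of the box ENERGY, or a Bałaban large-field-REGION
bound at level 0 consumes: `Σ_{a∈Q} dist₁² ≤ (E·#Q + u)/(c·β_K)` with probability `≥ 1 − e^{−u}`, uniformly in `K`, `γ ≤ 1` and the volume.

HONEST SCOPE.  Level-0 measure theory over landed theorems.  NOTHING of (R) `stub_mesoscopicBoxConcentration`, of K1 (23532), K1-exp,
(Q)/`MeanDeviationL` (23083/23133/23134), `HistoryTailL` (19936) or of rung R3 (`YM3TorusSU2` — a RECORD rung: not d = 4, not infinite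
volume, not a mass gap, not Clay) is proved here; the Yang–Mills mass gap is NOT touched.

References: J. Fröhlich, R. Israel, E. H. Lieb, B. Simon, CMP **62** (1978) 1–34 [FrohlichIsraelLiebSimon1978] (Thm 4.1);
T. Bałaban, CMP **102** (1985) 255–275 [Balaban1985UV3] ((5) p.256, (7) p.257, (11) p.258).
-/

set_option autoImplicit false

noncomputable section

namespace Summit.QuantumFields.YangMills.Theorems.UnitScaleGibbsRegionalPlaquetteExpMoment

open MeasureTheory ProbabilityTheory Finset
open Literature.MathematicalPhysics.QuantumFieldTheory
open Literature.MathematicalPhysics.QuantumFieldTheory.Balaban1983to89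
open Literature.MathematicalPhysics.QuantumFieldTheory.Balaban1983to89.T3ContinuumYM3Torus
open Literature.MathematicalPhysics.QuantumFieldTheory.Balaban1983to89.T3UnitScaleTilt
open Literature.MathematicalPhysics.QuantumFieldTheory.Balaban1983to89.T3UnitLawDensityEML (ℰp)
open Literature.MathematicalPhysics.QuantumFieldTheory.Balaban1983to89.T4StabilityFloorUnitary (wilsonAction4_eq_sum)
open Literature.MathematicalPhysics.QuantumFieldTheory.Balaban1983to89.B10Eq71TorusLocal (dist1_sq_le_specialUnitaryGroup)
open Literature.MathematicalPhysics.QuantumFieldTheory.Balaban1983to89.T3UpperLiftSplit (scheme_β_eq)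
open Literature.Barriers.CriticalPhenomena.NonGibbs (BlockIdx)
open Summit.QuantumFields.YangMills.BalabanUVNodes.N20LCSRestrictedChessboard (chessboard_exp_cubeEnergy expect_mul_prod_mono
  expect_mul_prod_nonneg cubeEnergy_mem measurable_cubeEnergy plaqTerm_mem)
open Literature.MathematicalPhysics.QuantumFieldTheory.Balaban1983to89.T4PairDerivBridge (dist1_le_two_specialUnitaryGroup)
open Summit.QuantumFields.YangMills.Theorems.CoarseStiffnessTailPressureConvexity (integral_exp_mul_action_eq wilsonAction4_mem
  measurable_dist1_plaqHol)
open Summit.QuantumFields.YangMills.Theorems.CoarseStiffnessTailUniformMeanAction (log_partitionFn_ratio_le_exact)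

/-! ## §1 Cube bookkeeping and the chessboard with trivial weight (any `Params`, `SU(N)`) -/

section Cubes

variable {N : ℕ} [NeZero N] {P : Params}

/-- **EVERY PLAQUETTE LIES IN THE CLOSED UNIT CUBE CORNERED AT ITS BASE POINT**, hence the energy of a finite plaquette set `Q` is at most the
sum of the cube energies `E_c = Σ_{p ⊂ [c,c+1]^d}(1 − Re tr U(∂p))` over the base points of `Q` (each summand is `≥ 0`). [folklore] -/
theorem plaqEnergy_sum_le_cubeEnergy_sum [DecidableEq (BlockIdx P.d (P.sitesPerDir 0))]
    (U : GaugeField P 0 (Matrix.specialUnitaryGroup (Fin N) ℂ)) (Q : Finset (Plaq P 0)) :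
    ∑ a ∈ Q, (1 - reTr (GaugeField.plaqHol U a)) ≤
      ∑ c ∈ Q.image (fun a : Plaq P 0 => (a.src : BlockIdx P.d (P.sitesPerDir 0))),
        (∑ p : Plaq P 0, if (∀ κ, p.src κ = c κ ∨ (κ ≠ p.μ ∧ κ ≠ p.ν ∧ p.src κ = c κ + 1))
          then (1 - reTr (GaugeField.plaqHol U p)) else 0) := by
  classical
  rw [← Finset.sum_fiberwise_of_maps_to (g := fun a : Plaq P 0 => (a.src : BlockIdx P.d (P.sitesPerDir 0)))
    (t := Q.image (fun a : Plaq P 0 => (a.src : BlockIdx P.d (P.sitesPerDir 0)))) (fun a ha => Finset.mem_image_of_mem _ ha)]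
  refine Finset.sum_le_sum fun c _ => ?_
  rw [← Finset.sum_filter]
  refine Finset.sum_le_sum_of_subset_of_nonneg (fun a ha => ?_) (fun p _ _ => (plaqTerm_mem U p).1)
  rw [Finset.mem_filter] at ha ⊢
  refine ⟨Finset.mem_univ _, fun κ => Or.inl ?_⟩
  rw [← ha.2]

/-- The torus expectation of the constant `1` is `1` (`Z > 0` for `β ≥ 0`). [folklore] -/
theorem expect_one (P : Params) {β : ℝ} (hβ : 0 ≤ β) :
    Missing.expect (G := Matrix.specialUnitaryGroup (Fin N) ℂ) P β (fun _ => (1 : ℝ)) = 1 := by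
  unfold Missing.expect
  simp only [one_mul]
  exact div_self (Missing.partitionFn_pos' (G := Matrix.specialUnitaryGroup (Fin N) ℂ) P hβ).ne'

/-- **THE CHESSBOARD FOR CUBE PRODUCTS, TRIVIAL WEIGHT, IN INTEGRAL FORM**: for `β ≥ 0`, `t ≥ 0` and every finite set `S` of closed unit cubes,
`∫ ∏_{c∈S} e^{t·E_c} dμ_β ≤ (∫ ∏_c e^{t·E_c} dμ_β)^{#S/N₀^d}` under the Wilson–Gibbs law `μ_β = gibbsMeasure P β`
(✓`chessboard_exp_cubeEnergy` at `w ≡ 1`). [cite: FrohlichIsraelLiebSimon1978, Thm 4.1] -/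
theorem integral_prod_exp_cubeEnergy_le_rpow (P : Params) {β : ℝ} (hβ : 0 ≤ β) {t : ℝ} (ht : 0 ≤ t)
    (S : Finset (BlockIdx P.d (P.sitesPerDir 0))) :
    ∫ U, (∏ c ∈ S, Real.exp (t * (∑ p : Plaq P 0, if (∀ κ, p.src κ = c κ ∨ (κ ≠ p.μ ∧ κ ≠ p.ν ∧ p.src κ = c κ + 1))
          then (1 - reTr (GaugeField.plaqHol U p)) else 0)))
        ∂(T4GenFunBounds.gibbsMeasure P β : Measure (GaugeField P 0 (Matrix.specialUnitaryGroup (Fin N) ℂ))) ≤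
      (∫ U, (∏ c : BlockIdx P.d (P.sitesPerDir 0), Real.exp (t * (∑ p : Plaq P 0,
          if (∀ κ, p.src κ = c κ ∨ (κ ≠ p.μ ∧ κ ≠ p.ν ∧ p.src κ = c κ + 1)) then (1 - reTr (GaugeField.plaqHol U p)) else 0)))
        ∂(T4GenFunBounds.gibbsMeasure P β : Measure (GaugeField P 0 (Matrix.specialUnitaryGroup (Fin N) ℂ)))) ^
        ((S.card : ℝ) / (P.sitesPerDir 0 : ℝ) ^ P.d) := by
  have hw0 : ∀ _s : ℝ, (0 : ℝ) ≤ (fun _ : ℝ => (1 : ℝ)) _s := fun _ => zero_le_one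
  have hwm : Measurable (fun _ : ℝ => (1 : ℝ)) := measurable_const
  have hwb : ∃ K : ℝ, ∀ s : ℝ, (fun _ : ℝ => (1 : ℝ)) s ≤ K := ⟨1, fun _ => le_rfl⟩
  have hW : 0 < Missing.expect (G := Matrix.specialUnitaryGroup (Fin N) ℂ) P β
      (fun U => ∏ p : Plaq P 0, (fun _ : ℝ => (1 : ℝ)) (1 - reTr (GaugeField.plaqHol U p))) := by
    simp only [Finset.prod_const_one]
    rw [expect_one P hβ]
    exact one_pos
  have h := chessboard_exp_cubeEnergy (N := N) P hβ hw0 hwm hwb hW ht S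
  simp only [Finset.prod_const_one, mul_one, expect_one P hβ, div_one] at h
  rw [T4GenFunBounds.integral_gibbsMeasure_eq_expect P hβ, T4GenFunBounds.integral_gibbsMeasure_eq_expect P hβ]
  exact h

/-- In three dimensions a plaquette lies in AT MOST TWO closed unit cubes (the cube index agrees with the base point in the two plaquette
directions and is the base point or its predecessor in the third). [folklore] -/
theorem card_filter_inCube_le_two (hd : P.d = 3) (p : Plaq P 0) :
    (Finset.univ.filter fun c : BlockIdx P.d (P.sitesPerDir 0) =>
        ∀ κ, p.src κ = c κ ∨ (κ ≠ p.μ ∧ κ ≠ p.ν ∧ p.src κ = c κ + 1)).card ≤ 2 := by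
  classical
  -- the two candidates: the base point, and the base point lowered by one off the plaquette directions
  set c₁ : BlockIdx P.d (P.sitesPerDir 0) := fun κ => p.src κ with hc₁
  set c₂ : BlockIdx P.d (P.sitesPerDir 0) := fun κ => if κ = p.μ ∨ κ = p.ν then p.src κ else p.src κ - 1 with hc₂
  have hthird : ∀ κ κ₀ : Fin P.d, κ ≠ p.μ → κ ≠ p.ν → κ₀ ≠ p.μ → κ₀ ≠ p.ν → κ = κ₀ := by
    intro κ κ₀ h1 h2 h3 h4
    have hμν : p.μ.val < p.ν.val := p.hμν
    have := κ.isLt; have := κ₀.isLt; have := p.μ.isLt; have := p.ν.isLt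
    rw [Ne, Fin.ext_iff] at h1 h2 h3 h4
    rw [Fin.ext_iff]
    omega
  have hsub : (Finset.univ.filter fun c : BlockIdx P.d (P.sitesPerDir 0) =>
      ∀ κ, p.src κ = c κ ∨ (κ ≠ p.μ ∧ κ ≠ p.ν ∧ p.src κ = c κ + 1)) ⊆ {c₁, c₂} := by
    intro c hc
    rw [Finset.mem_filter] at hc
    obtain ⟨-, hc⟩ := hc
    rw [Finset.mem_insert, Finset.mem_singleton]
    by_cases h : c = c₁
    · exact Or.inl h
    · right
      -- `c` differs from the base point at some coordinate `κ₀`, necessarily off the plaquette directions, where it is lowered by one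
      have hne : ∃ κ₀, c κ₀ ≠ p.src κ₀ := by
        by_contra hall
        push Not at hall
        exact h (funext fun κ => by rw [hc₁]; exact hall κ)
      obtain ⟨κ₀, hκ₀⟩ := hne
      have hκ₀' : κ₀ ≠ p.μ ∧ κ₀ ≠ p.ν ∧ p.src κ₀ = c κ₀ + 1 := by
        rcases hc κ₀ with h0 | h0
        · exact absurd h0.symm hκ₀
        · exact h0
      funext κ
      rw [hc₂]
      dsimp only
      by_cases hκ : κ = p.μ ∨ κ = p.ν
      · rw [if_pos hκ]
        rcases hc κ with h0 | h0
        · exact h0.symm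
        · rcases hκ with hκ | hκ
          · exact absurd hκ h0.1
          · exact absurd hκ h0.2.1
      · rw [if_neg hκ]
        push Not at hκ
        have hκκ₀ : κ = κ₀ := hthird κ κ₀ hκ.1 hκ.2 hκ₀'.1 hκ₀'.2.1
        subst hκκ₀
        rw [hκ₀'.2.2, add_sub_cancel_right]
  exact (Finset.card_le_card hsub).trans (Finset.card_le_two)

/-- **In three dimensions the sum of all cube energies is at most TWICE the action**: `Σ_c E_c(U) ≤ 2·Σ_p (1 − Re tr U(∂p))`
(the `2^d` of ✓`N20LCSConditional.sum_cubeEnergy_le` sharpened to the exact multiplicity for `d = 3`). [folklore] -/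
theorem sum_cubeEnergy_le_two_mul (hd : P.d = 3) (U : GaugeField P 0 (Matrix.specialUnitaryGroup (Fin N) ℂ)) :
    ∑ c : BlockIdx P.d (P.sitesPerDir 0), (∑ p : Plaq P 0, if (∀ κ, p.src κ = c κ ∨ (κ ≠ p.μ ∧ κ ≠ p.ν ∧ p.src κ = c κ + 1))
        then (1 - reTr (GaugeField.plaqHol U p)) else 0) ≤
      2 * ∑ p : Plaq P 0, (1 - reTr (GaugeField.plaqHol U p)) := by
  classical
  rw [Finset.sum_comm, Finset.mul_sum]
  refine Finset.sum_le_sum fun p _ => ?_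
  rw [← Finset.sum_filter, Finset.sum_const, nsmul_eq_mul]
  have h0 : 0 ≤ 1 - reTr (GaugeField.plaqHol U p) := (plaqTerm_mem U p).1
  have hcard := card_filter_inCube_le_two (P := P) hd p
  calc ((Finset.univ.filter fun c : BlockIdx P.d (P.sitesPerDir 0) =>
          ∀ κ, p.src κ = c κ ∨ (κ ≠ p.μ ∧ κ ≠ p.ν ∧ p.src κ = c κ + 1)).card : ℝ) * (1 - reTr (GaugeField.plaqHol U p))
      ≤ (2 : ℕ) * (1 - reTr (GaugeField.plaqHol U p)) := mul_le_mul_of_nonneg_right (by exact_mod_cast hcard) h0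
    _ = 2 * (1 - reTr (GaugeField.plaqHol U p)) := by push_cast; ring

/-- **THE FULL CUBE PRODUCT IS A RATIO OF PARTITION FUNCTIONS** (`d = 3`): `∫ ∏_c e^{t·E_c} dμ_β ≤ Z(β − 2t)/Z(β)` for `β, t ≥ 0`
(`Σ_c E_c ≤ 2·A` pointwise; `∫ e^{sA} dμ_β = Z(β − s)/Z(β)`, ✓`integral_exp_mul_action_eq`). [folklore] -/
theorem integral_prod_exp_cubeEnergy_le_ratio (P : Params) (hd : P.d = 3) {β : ℝ} (hβ : 0 ≤ β) {t : ℝ} (ht : 0 ≤ t) :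
    ∫ U, (∏ c : BlockIdx P.d (P.sitesPerDir 0), Real.exp (t * (∑ p : Plaq P 0,
          if (∀ κ, p.src κ = c κ ∨ (κ ≠ p.μ ∧ κ ≠ p.ν ∧ p.src κ = c κ + 1)) then (1 - reTr (GaugeField.plaqHol U p)) else 0)))
        ∂(T4GenFunBounds.gibbsMeasure P β : Measure (GaugeField P 0 (Matrix.specialUnitaryGroup (Fin N) ℂ))) ≤
      Missing.partitionFn (G := Matrix.specialUnitaryGroup (Fin N) ℂ) P (β - 2 * t) /
        Missing.partitionFn (G := Matrix.specialUnitaryGroup (Fin N) ℂ) P β := by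
  haveI := T4GenFunBounds.isProbabilityMeasure_gibbsMeasure (G := Matrix.specialUnitaryGroup (Fin N) ℂ) P hβ
  rw [← integral_exp_mul_action_eq (G := Matrix.specialUnitaryGroup (Fin N) ℂ) P hβ (2 * t)]
  have h2 : (0 : ℝ) ≤ 2 * t := by positivity
  -- integrability of the dominating function (bounded on a probability space)
  have hmeasA : Measurable fun U : GaugeField P 0 (Matrix.specialUnitaryGroup (Fin N) ℂ) => Real.exp (2 * t * wilsonAction4 U) :=
    Real.measurable_exp.comp ((Missing.measurable_wilsonAction4 RegularGaugeGroup.measurable_reTr).const_mul _)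
  have hintA : Integrable (fun U : GaugeField P 0 (Matrix.specialUnitaryGroup (Fin N) ℂ) => Real.exp (2 * t * wilsonAction4 U))
      (T4GenFunBounds.gibbsMeasure P β) := by
    refine (integrable_const (Real.exp (2 * t * (2 * (Fintype.card (Plaq P 0) : ℝ))))).mono'
      hmeasA.aestronglyMeasurable (ae_of_all _ fun U => ?_)
    rw [Real.norm_eq_abs, abs_of_pos (Real.exp_pos _)]
    exact Real.exp_le_exp.mpr (mul_le_mul_of_nonneg_left (wilsonAction4_mem U).2 h2)
  refine integral_mono_of_nonneg (ae_of_all _ fun U => Finset.prod_nonneg fun c _ => (Real.exp_pos _).le) hintA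
    (ae_of_all _ fun U => ?_)
  -- pointwise: `∏_c e^{tE_c} = e^{tΣ_c E_c} ≤ e^{2tA}`
  show (∏ c : BlockIdx P.d (P.sitesPerDir 0), Real.exp (t * (∑ p : Plaq P 0,
          if (∀ κ, p.src κ = c κ ∨ (κ ≠ p.μ ∧ κ ≠ p.ν ∧ p.src κ = c κ + 1)) then (1 - reTr (GaugeField.plaqHol U p)) else 0))) ≤
      Real.exp (2 * t * wilsonAction4 U)
  rw [← Real.exp_sum, ← Finset.mul_sum]
  refine Real.exp_le_exp.mpr ?_
  rw [wilsonAction4_eq_sum, mul_comm (2 : ℝ) t, mul_assoc]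
  exact mul_le_mul_of_nonneg_left (sum_cubeEnergy_le_two_mul (N := N) hd U) ht

end Cubes

/-! ## §2 The regional exponential moment on Bałaban's three-tori, `G = SU(2)`, uniformly in `β ≥ 1` and the volume -/

section Torus

/-- **LOCAL EXPONENTIAL MOMENTS OF THE PLAQUETTE ENERGIES, d = 3, `SU(2)`, UNCONDITIONAL.**  There is one absolute `E ≥ 0` such that for every
`d = 3` parameter set `P`, every `β ≥ 1`, every `0 ≤ a ≤ 1/4` and every finite set `Q` of finest plaquettes:
`∫ exp(a·β·Σ_{p∈Q}(1 − Re tr U(∂p))) d(gibbsMeasure P β) ≤ exp(E·#Q)` — the regional energy costs `e^{O(#Q)}` at the natural scale `1/β`,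
uniformly in `β ≥ 1` and in the volume (the d = 3 twin of Track A's `P.d = 4`-only ✓`N20LCSAtRecordLevelZero.localExpMoment_gibbsMeasure`,
made unconditional by the exact torus free energy ✓`log_partitionFn_ratio_le_exact`). [cite: FrohlichIsraelLiebSimon1978, Thm 4.1] -/
theorem localExpMoment_gibbsMeasure_d3 :
    ∃ E : ℝ, 0 ≤ E ∧ ∀ (P : Params), P.d = 3 → ∀ (β : ℝ), 1 ≤ β → ∀ (a : ℝ), 0 ≤ a → a ≤ 1 / 4 →
      ∀ (Q : Finset (Plaq P 0)),
        ∫ U, Real.exp (a * β * ∑ p ∈ Q, (1 - reTr (GaugeField.plaqHol U p)))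
            ∂(T4GenFunBounds.gibbsMeasure P β : Measure (GaugeField P 0 (Matrix.specialUnitaryGroup (Fin 2) ℂ))) ≤
          Real.exp (E * Q.card) := by
  classical
  obtain ⟨E, hE0, hE⟩ := log_partitionFn_ratio_le_exact
  refine ⟨E, hE0, fun P hd β hβ1 a ha0 ha Q => ?_⟩
  have hβ0 : 0 < β := lt_of_lt_of_le one_pos hβ1
  haveI := T4GenFunBounds.isProbabilityMeasure_gibbsMeasure (G := Matrix.specialUnitaryGroup (Fin 2) ℂ) P hβ0.le
  have ht0 : 0 ≤ a * β := by positivity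
  have hScard : ((Q.image (fun q : Plaq P 0 => (q.src : BlockIdx P.d (P.sitesPerDir 0)))).card : ℝ) ≤ (Q.card : ℝ) := by
    exact_mod_cast Finset.card_image_le
  -- (1) the cube product over the base points of `Q` dominates the regional energy, pointwise; integrate
  have hptw : ∀ U : GaugeField P 0 (Matrix.specialUnitaryGroup (Fin 2) ℂ),
      Real.exp (a * β * ∑ p ∈ Q, (1 - reTr (GaugeField.plaqHol U p))) ≤
        ∏ c ∈ Q.image (fun q : Plaq P 0 => (q.src : BlockIdx P.d (P.sitesPerDir 0))),
          Real.exp (a * β * (∑ p : Plaq P 0, if (∀ κ, p.src κ = c κ ∨ (κ ≠ p.μ ∧ κ ≠ p.ν ∧ p.src κ = c κ + 1))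
            then (1 - reTr (GaugeField.plaqHol U p)) else 0)) := fun U => by
    rw [← Real.exp_sum, ← Finset.mul_sum]
    exact Real.exp_le_exp.mpr (mul_le_mul_of_nonneg_left (plaqEnergy_sum_le_cubeEnergy_sum (N := 2) U Q) ht0)
  have hGm : Measurable fun U : GaugeField P 0 (Matrix.specialUnitaryGroup (Fin 2) ℂ) =>
      ∏ c ∈ Q.image (fun q : Plaq P 0 => (q.src : BlockIdx P.d (P.sitesPerDir 0))),
        Real.exp (a * β * (∑ p : Plaq P 0, if (∀ κ, p.src κ = c κ ∨ (κ ≠ p.μ ∧ κ ≠ p.ν ∧ p.src κ = c κ + 1))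
          then (1 - reTr (GaugeField.plaqHol U p)) else 0)) :=
    Finset.measurable_prod _ fun c _ => Real.measurable_exp.comp ((measurable_cubeEnergy (N := 2) c).const_mul _)
  have hGint : Integrable (fun U : GaugeField P 0 (Matrix.specialUnitaryGroup (Fin 2) ℂ) =>
      ∏ c ∈ Q.image (fun q : Plaq P 0 => (q.src : BlockIdx P.d (P.sitesPerDir 0))),
        Real.exp (a * β * (∑ p : Plaq P 0, if (∀ κ, p.src κ = c κ ∨ (κ ≠ p.μ ∧ κ ≠ p.ν ∧ p.src κ = c κ + 1))
          then (1 - reTr (GaugeField.plaqHol U p)) else 0))) (T4GenFunBounds.gibbsMeasure P β) := by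
    refine (integrable_const (Real.exp (a * β * (2 * Fintype.card (Plaq P 0))) ^
      (Q.image (fun q : Plaq P 0 => (q.src : BlockIdx P.d (P.sitesPerDir 0)))).card)).mono' hGm.aestronglyMeasurable
      (ae_of_all _ fun U => ?_)
    rw [Real.norm_eq_abs, abs_of_nonneg (Finset.prod_nonneg fun c _ => (Real.exp_pos _).le), ← Finset.prod_const]
    exact Finset.prod_le_prod (fun c _ => (Real.exp_pos _).le) fun c _ =>
      Real.exp_le_exp.mpr (mul_le_mul_of_nonneg_left (cubeEnergy_mem (N := 2) c U).2 ht0)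
  have hstep1 := integral_mono_of_nonneg (μ := T4GenFunBounds.gibbsMeasure P β)
    (ae_of_all _ fun U => (Real.exp_pos (a * β * ∑ p ∈ Q, (1 - reTr (GaugeField.plaqHol U p)))).le) hGint (ae_of_all _ hptw)
  -- (2) chessboard over the cubes, and the global ratio `Z(β − 2aβ)/Z(β) ≤ e^{E|T|}` (`4a ≤ 1`)
  have hchess := integral_prod_exp_cubeEnergy_le_rpow (N := 2) P hβ0.le ht0
    (Q.image (fun q : Plaq P 0 => (q.src : BlockIdx P.d (P.sitesPerDir 0))))
  have hglob := integral_prod_exp_cubeEnergy_le_ratio (N := 2) P hd hβ0.le ht0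
  have hβ'0 : 0 < β - 2 * (a * β) := by nlinarith
  have hββ' : β ≤ 2 * (β - 2 * (a * β)) := by nlinarith
  have hZ : 0 < Missing.partitionFn (G := Matrix.specialUnitaryGroup (Fin 2) ℂ) P β := Missing.partitionFn_pos' P hβ0.le
  have hZ' : 0 < Missing.partitionFn (G := Matrix.specialUnitaryGroup (Fin 2) ℂ) P (β - 2 * (a * β)) :=
    Missing.partitionFn_pos' P hβ'0.le
  have hratio : Missing.partitionFn (G := Matrix.specialUnitaryGroup (Fin 2) ℂ) P (β - 2 * (a * β)) /
      Missing.partitionFn (G := Matrix.specialUnitaryGroup (Fin 2) ℂ) P β ≤ Real.exp (E * (Fintype.card (Site P 0) : ℝ)) := by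
    rw [← Real.exp_log hZ', ← Real.exp_log hZ, ← Real.exp_sub]
    exact Real.exp_le_exp.mpr (hE P hd β (β - 2 * (a * β)) hβ1 hβ'0 hββ')
  have hfull := hglob.trans hratio
  have hfull0 : 0 ≤ ∫ U, (∏ c : BlockIdx P.d (P.sitesPerDir 0), Real.exp (a * β * (∑ p : Plaq P 0,
          if (∀ κ, p.src κ = c κ ∨ (κ ≠ p.μ ∧ κ ≠ p.ν ∧ p.src κ = c κ + 1)) then (1 - reTr (GaugeField.plaqHol U p)) else 0)))
        ∂(T4GenFunBounds.gibbsMeasure P β : Measure (GaugeField P 0 (Matrix.specialUnitaryGroup (Fin 2) ℂ))) :=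
    integral_nonneg fun U => Finset.prod_nonneg fun c _ => (Real.exp_pos _).le
  -- (3) raise to the volume fraction `#S/N₀³`; `|T| = N₀³`
  have hNpos : (0 : ℝ) < (P.sitesPerDir 0 : ℝ) := by exact_mod_cast Nat.pos_of_ne_zero (P.sitesPerDir_ne_zero 0)
  have hN0 : (0 : ℝ) < (P.sitesPerDir 0 : ℝ) ^ P.d := pow_pos hNpos _
  have hexp0 : 0 ≤ ((Q.image (fun q : Plaq P 0 => (q.src : BlockIdx P.d (P.sitesPerDir 0)))).card : ℝ) /
      (P.sitesPerDir 0 : ℝ) ^ P.d := div_nonneg (Nat.cast_nonneg _) hN0.le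
  have hVeq : (Fintype.card (Site P 0) : ℝ) = (P.sitesPerDir 0 : ℝ) ^ P.d := by
    rw [Site.card_site P 0, Nat.cast_pow]
  have hpow := Real.rpow_le_rpow hfull0 hfull hexp0
  have hrhs : Real.exp (E * (Fintype.card (Site P 0) : ℝ)) ^
      (((Q.image (fun q : Plaq P 0 => (q.src : BlockIdx P.d (P.sitesPerDir 0)))).card : ℝ) / (P.sitesPerDir 0 : ℝ) ^ P.d) =
        Real.exp (E * ((Q.image (fun q : Plaq P 0 => (q.src : BlockIdx P.d (P.sitesPerDir 0)))).card : ℝ)) := by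
    rw [← Real.exp_mul, hVeq, mul_assoc, mul_div_cancel₀ _ hN0.ne']
  rw [hrhs] at hpow
  refine hstep1.trans ((hchess.trans hpow).trans (Real.exp_le_exp.mpr (mul_le_mul_of_nonneg_left hScard hE0)))

end Torus

/-! ## §3 The reading for the level-`K` Wilson–Gibbs law `gibbsK` of a `T3Family`, in the `dist₁²` currency -/

section Family

variable (F : T3Family)

/-- On `SU(2)`: `Σ_{a∈Q} |U(∂a) − 1|² ≤ 4·Σ_{a∈Q}(1 − Re tr U(∂a))` ([Balaban1985UV3] (11): `|W − 1|² ≤ 2N(1 − Re tr W)`, `N = 2`).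
[cite: Balaban1985UV3, (11) p.258] -/
theorem sqSum_region_le_four_mul {K : ℕ} (U : GaugeField (F.P K) 0 (Matrix.specialUnitaryGroup (Fin 2) ℂ)) (Q : Finset (Plaq (F.P K) 0)) :
    ∑ a ∈ Q, dist1 (GaugeField.plaqHol U a) ^ 2 ≤ 4 * ∑ a ∈ Q, (1 - reTr (GaugeField.plaqHol U a)) := by
  rw [Finset.mul_sum]
  refine Finset.sum_le_sum fun a _ => ?_
  have h := dist1_sq_le_specialUnitaryGroup (N := 2) (GaugeField.plaqHol U a)
  calc dist1 (GaugeField.plaqHol U a) ^ 2 ≤ 2 * (((2 : ℕ) : ℝ) * (1 - reTr (GaugeField.plaqHol U a))) := h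
    _ = 4 * (1 - reTr (GaugeField.plaqHol U a)) := by push_cast; ring

/-- ★★★ **REGIONAL BARE STIFFNESS.**  There is one absolute `E ≥ 0` such that for every family `F`, every `0 < γ ≤ 1`, every cut-off `K`,
EVERY finite set `Q` of finest plaquettes and every `0 ≤ c ≤ 1/16`:
`∫ exp(c·β_K·Σ_{a∈Q} dist₁(U(∂a))²) dGibbs_K ≤ exp(E·#Q)`, `β_K = (γL^{−K})⁻¹` — ✓`exists_bareStiffness_le` (`Q = univ`, `e^{E·#Plaq₀}`)
LOCALISED to arbitrary regions, NO power of `β_K`, NO volume factor. [cite: FrohlichIsraelLiebSimon1978, Thm 4.1; Balaban1985UV3, (11) p.258] -/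
theorem exists_regional_expMoment_le :
    ∃ E : ℝ, 0 ≤ E ∧ ∀ (F : T3Family) (γ : ℝ), 0 < γ → γ ≤ 1 → ∀ (K : ℕ) (Q : Finset (Plaq (F.P K) 0)) (c : ℝ), 0 ≤ c → c ≤ 1 / 16 →
      ∫ U, Real.exp (c * (γ * ((F.L : ℝ)⁻¹) ^ K)⁻¹ * ∑ a ∈ Q, dist1 (GaugeField.plaqHol U a) ^ 2) ∂(gibbsK F ℰp γ K) ≤
        Real.exp (E * Q.card) := by
  obtain ⟨E, hE0, hE⟩ := localExpMoment_gibbsMeasure_d3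
  refine ⟨E, hE0, fun F γ hγ hγ1 K Q c hc0 hc => ?_⟩
  set β : ℝ := (γ * ((F.L : ℝ)⁻¹) ^ K)⁻¹ with hβdef
  have hβ1 : 1 ≤ β := by
    have hL1 : (1 : ℝ) ≤ F.L := by exact_mod_cast F.hL.2.le
    have hx0 : 0 < ((F.L : ℝ)⁻¹) ^ K := pow_pos (inv_pos.2 (by linarith)) K
    have hx : ((F.L : ℝ)⁻¹) ^ K ≤ 1 := pow_le_one₀ (inv_nonneg.2 (by linarith)) (inv_le_one_of_one_le₀ hL1)
    exact (one_le_inv₀ (mul_pos hγ hx0)).2 (by nlinarith)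
  have hβ0 : 0 < β := lt_of_lt_of_le one_pos hβ1
  haveI := isProbabilityMeasure_gibbsK F ℰp hγ.le K
  -- pointwise: `exp(c β Σ_Q d²) ≤ exp(4c β Σ_Q (1 − Re tr))`
  have hptw : ∀ U : GaugeField (F.P K) 0 (Matrix.specialUnitaryGroup (Fin 2) ℂ),
      Real.exp (c * β * ∑ a ∈ Q, dist1 (GaugeField.plaqHol U a) ^ 2) ≤
        Real.exp (4 * c * β * ∑ a ∈ Q, (1 - reTr (GaugeField.plaqHol U a))) := fun U => by
    refine Real.exp_le_exp.mpr ?_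
    have h4 := sqSum_region_le_four_mul F U Q
    have hcb : 0 ≤ c * β := by positivity
    calc c * β * ∑ a ∈ Q, dist1 (GaugeField.plaqHol U a) ^ 2 ≤ c * β * (4 * ∑ a ∈ Q, (1 - reTr (GaugeField.plaqHol U a))) :=
          mul_le_mul_of_nonneg_left h4 hcb
      _ = 4 * c * β * ∑ a ∈ Q, (1 - reTr (GaugeField.plaqHol U a)) := by ring
  have hmeas : Measurable fun U : GaugeField (F.P K) 0 (Matrix.specialUnitaryGroup (Fin 2) ℂ) =>
      Real.exp (4 * c * β * ∑ a ∈ Q, (1 - reTr (GaugeField.plaqHol U a))) :=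
    Real.measurable_exp.comp ((Finset.measurable_sum _ fun a _ => measurable_const.sub
      (RegularGaugeGroup.measurable_reTr.comp (Missing.measurable_plaqHol (G := Matrix.specialUnitaryGroup (Fin 2) ℂ) a))).const_mul _)
  have h4c : 0 ≤ 4 * c * β := by positivity
  have hint : Integrable (fun U : GaugeField (F.P K) 0 (Matrix.specialUnitaryGroup (Fin 2) ℂ) =>
      Real.exp (4 * c * β * ∑ a ∈ Q, (1 - reTr (GaugeField.plaqHol U a)))) (gibbsK F ℰp γ K) := by
    refine (integrable_const (Real.exp (4 * c * β * (2 * (Q.card : ℝ))))).mono' hmeas.aestronglyMeasurable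
      (ae_of_all _ fun U => ?_)
    rw [Real.norm_eq_abs, abs_of_pos (Real.exp_pos _)]
    refine Real.exp_le_exp.mpr (mul_le_mul_of_nonneg_left ?_ h4c)
    calc ∑ a ∈ Q, (1 - reTr (GaugeField.plaqHol U a)) ≤ ∑ _a ∈ Q, (2 : ℝ) :=
          Finset.sum_le_sum fun a _ => (plaqTerm_mem (N := 2) U a).2
      _ = 2 * (Q.card : ℝ) := by rw [Finset.sum_const, nsmul_eq_mul, mul_comm]
  calc ∫ U, Real.exp (c * β * ∑ a ∈ Q, dist1 (GaugeField.plaqHol U a) ^ 2) ∂(gibbsK F ℰp γ K)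
      ≤ ∫ U, Real.exp (4 * c * β * ∑ a ∈ Q, (1 - reTr (GaugeField.plaqHol U a))) ∂(gibbsK F ℰp γ K) :=
        integral_mono_of_nonneg (ae_of_all _ fun U => (Real.exp_pos _).le) hint (ae_of_all _ hptw)
    _ ≤ Real.exp (E * Q.card) := by
        rw [gibbsK_eq, scheme_β_eq]
        exact hE (F.P K) (T3Family.P_d F K) β hβ1 (4 * c) (by positivity) (by linarith) Q

end Family

end Summit.QuantumFields.YangMills.Theorems.UnitScaleGibbsRegionalPlaquetteExpMoment

end
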